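import Mathlib
import HarnessLib
import Summits.AtomisticToContinuum.Crystallization.Theorems.PricedLinkCensusSoftFourRingsRigArith

/-!
# Soft four-rings, metric half by certified numerics (2): placing a point from two neighbours

Route `PricedLinkCensus`, sub-problem `Crystallization`, item `SoftFourRings`
(stmt-AtomisticToContinuum-14234).  The one geometric step of the construction behind the
checker: a unit vector `v ∈ ℝ³` with prescribed inner products `⟪v, a⟫ = κa`, `⟪v, b⟫ = κb` with
two unit vectors `a, b` (`⟪a, b⟫ = g`, `g² < 1`) is

  `v = λ a + μ b ± √ρ (a × b)`,  `λ = (κa − g κb)/(1 − g²)`, `μ = (κb − g κa)/(1 − g²)`,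
  `ρ = (1 − λ κa − μ κb)/(1 − g²) ≥ 0`

(`place_decomp`: the component of `v` orthogonal to `a, b` is parallel to `a × b`, by the
Lagrange identity, and its length is read off `|v| = 1`).  The interval version `place`
evaluates both branches in the fixed-point arithmetic of `…RigArith`, and `mem_place` is its
inclusion theorem: `v` lies in one of the two returned boxes.
-/

namespace Summit.AtomisticToContinuum.Crystallization.Theorems

namespace Rig

open Literature.Analysis.ValidatedNumerics.NumericsMP
open scoped Matrix

/-! ### The real decomposition -/

/-- `v ⬝ᵥ v ≥ 0` for real vectors. -/
theorem dotProduct_self_nonneg' {n : Type*} [Fintype n] (v : n → ℝ) : 0 ≤ v ⬝ᵥ v :=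
  Finset.sum_nonneg fun i _ => mul_self_nonneg (v i)

/-- `λ = (κa − g κb)/(1 − g²)`. -/
noncomputable def lamR (g ka kb : ℝ) : ℝ := (ka - g * kb) / (1 - g ^ 2)
/-- `μ = (κb − g κa)/(1 − g²)`. -/
noncomputable def muR (g ka kb : ℝ) : ℝ := (kb - g * ka) / (1 - g ^ 2)
/-- `ρ = (1 − λ κa − μ κb)/(1 − g²)`. -/
noncomputable def radR (g ka kb : ℝ) : ℝ := (1 - lamR g ka kb * ka - muR g ka kb * kb) / (1 - g ^ 2)

/-- The branch expression `λ a + μ b ± √ρ (a × b)` (`true` : `+`). -/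
noncomputable def brExpr (sgn : Bool) (a b : Fin 3 → ℝ) (ka kb : ℝ) : Fin 3 → ℝ :=
  lamR (a ⬝ᵥ b) ka kb • a + muR (a ⬝ᵥ b) ka kb • b +
    ((if sgn then (1 : ℝ) else -1) * Real.sqrt (radR (a ⬝ᵥ b) ka kb)) • (a ⨯₃ b)

/-- **Placement from two neighbours.**  A unit vector `v` with `⟪v,a⟫ = κa`, `⟪v,b⟫ = κb`
(`a, b` unit, `⟪a,b⟫ = g`, `g² < 1`) is `λ a + μ b ± √ρ (a × b)` with the displayed `λ, μ, ρ`,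
and `ρ ≥ 0`. -/
theorem place_decomp {a b v : Fin 3 → ℝ} (ha : a ⬝ᵥ a = 1) (hb : b ⬝ᵥ b = 1) (hv : v ⬝ᵥ v = 1)
    {g ka kb : ℝ} (hg : a ⬝ᵥ b = g) (hka : v ⬝ᵥ a = ka) (hkb : v ⬝ᵥ b = kb) (hg1 : g ^ 2 < 1) :
    0 ≤ (1 - (ka - g * kb) / (1 - g ^ 2) * ka - (kb - g * ka) / (1 - g ^ 2) * kb) / (1 - g ^ 2) ∧
    (v = ((ka - g * kb) / (1 - g ^ 2)) • a + ((kb - g * ka) / (1 - g ^ 2)) • b +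
        Real.sqrt ((1 - (ka - g * kb) / (1 - g ^ 2) * ka - (kb - g * ka) / (1 - g ^ 2) * kb) /
          (1 - g ^ 2)) • (a ⨯₃ b) ∨
     v = ((ka - g * kb) / (1 - g ^ 2)) • a + ((kb - g * ka) / (1 - g ^ 2)) • b +
        (-Real.sqrt ((1 - (ka - g * kb) / (1 - g ^ 2) * ka - (kb - g * ka) / (1 - g ^ 2) * kb) /
          (1 - g ^ 2))) • (a ⨯₃ b)) := by
  have hD : 0 < 1 - g ^ 2 := by linarith
  have hD0 : 1 - g ^ 2 ≠ 0 := hD.ne'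
  set lam := (ka - g * kb) / (1 - g ^ 2) with hlam
  set mu := (kb - g * ka) / (1 - g ^ 2) with hmu
  set rad := (1 - lam * ka - mu * kb) / (1 - g ^ 2) with hrad
  set w := v - lam • a - mu • b with hw
  set c := a ⨯₃ b with hc
  have hba : b ⬝ᵥ a = g := by rw [dotProduct_comm]; exact hg
  -- `w ⊥ a`, `w ⊥ b`
  have hwa : w ⬝ᵥ a = 0 := by
    simp only [hw, sub_dotProduct, smul_dotProduct, smul_eq_mul, hka, ha, hba]
    rw [hlam, hmu]; field_simp; ring
  have hwb : w ⬝ᵥ b = 0 := by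
    simp only [hw, sub_dotProduct, smul_dotProduct, smul_eq_mul, hkb, hg, hb]
    rw [hlam, hmu]; field_simp; ring
  have haw : a ⬝ᵥ w = 0 := by rw [dotProduct_comm]; exact hwa
  have hbw : b ⬝ᵥ w = 0 := by rw [dotProduct_comm]; exact hwb
  -- `|c|² = 1 - g²`
  have hcc : c ⬝ᵥ c = 1 - g ^ 2 := by
    rw [hc, cross_dot_cross, ha, hb, hg, hba]; ring
  -- `c × w = 0`, hence Lagrange gives `|c|²|w|² = ⟪c,w⟫²`
  have hcw0 : c ⨯₃ w = 0 := by
    rw [hc, cross_cross_eq_smul_sub_smul, haw, hbw, zero_smul, zero_smul, sub_zero]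
  have hlag : (c ⬝ᵥ c) * (w ⬝ᵥ w) - (c ⬝ᵥ w) * (w ⬝ᵥ c) = 0 := by
    rw [← cross_dot_cross, hcw0]; simp
  have hwc : w ⬝ᵥ c = c ⬝ᵥ w := dotProduct_comm _ _
  rw [hwc, hcc] at hlag
  -- `|w|² = 1 - λ κa - μ κb`
  have hww : w ⬝ᵥ w = 1 - lam * ka - mu * kb := by
    have hz1 : w ⬝ᵥ (lam • a) = 0 := by rw [dotProduct_smul, hwa, smul_zero]
    have hz2 : w ⬝ᵥ (mu • b) = 0 := by rw [dotProduct_smul, hwb, smul_zero]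
    have h1 : w ⬝ᵥ w = w ⬝ᵥ v := by
      calc w ⬝ᵥ w = w ⬝ᵥ (v - lam • a - mu • b) := by rw [← hw]
        _ = w ⬝ᵥ v - w ⬝ᵥ (lam • a) - w ⬝ᵥ (mu • b) := by rw [dotProduct_sub, dotProduct_sub]
        _ = w ⬝ᵥ v := by rw [hz1, hz2]; ring
    have h2 : w ⬝ᵥ v = 1 - lam * ka - mu * kb := by
      calc w ⬝ᵥ v = (v - lam • a - mu • b) ⬝ᵥ v := by rw [← hw]
        _ = v ⬝ᵥ v - lam • a ⬝ᵥ v - mu • b ⬝ᵥ v := by rw [sub_dotProduct, sub_dotProduct]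
        _ = 1 - lam * ka - mu * kb := by
          rw [smul_dotProduct, smul_dotProduct, hv, dotProduct_comm a v, hka, dotProduct_comm b v,
            hkb, smul_eq_mul, smul_eq_mul]
    rw [h1, h2]
  -- `rad = |w|²/(1-g²) ≥ 0`
  have hrad' : rad = (w ⬝ᵥ w) / (1 - g ^ 2) := by rw [hrad, hww]
  have hrad0 : 0 ≤ rad := by rw [hrad']; exact div_nonneg (dotProduct_self_nonneg' w) hD.le
  refine ⟨hrad0, ?_⟩
  -- `w = ν₀ c` with `ν₀ = ⟪c,w⟫/(1-g²)`
  set nu := (c ⬝ᵥ w) / (1 - g ^ 2) with hnu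
  have hwnu : w = nu • c := by
    have key : w ⬝ᵥ w - (c ⬝ᵥ w) ^ 2 / (1 - g ^ 2) = 0 := by
      rw [sub_eq_zero, eq_div_iff hD0]
      linear_combination hlag
    have hn1 : nu * (c ⬝ᵥ w) = (c ⬝ᵥ w) ^ 2 / (1 - g ^ 2) := by rw [hnu]; ring
    have hn2 : nu * (nu * (c ⬝ᵥ c)) = (c ⬝ᵥ w) ^ 2 / (1 - g ^ 2) := by
      rw [hnu, hcc]; field_simp
    have hzero : (w - nu • c) ⬝ᵥ (w - nu • c) = 0 := by
      simp only [sub_dotProduct, dotProduct_sub, smul_dotProduct, dotProduct_smul, smul_eq_mul]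
      rw [hwc, mul_sub, hn1, hn2]
      linarith [key]
    have := (dotProduct_self_eq_zero.1 hzero)
    exact sub_eq_zero.1 this
  -- `ν₀² = rad`
  have hnu2 : nu ^ 2 = rad := by
    rw [hnu, hrad', div_pow, div_eq_div_iff (pow_ne_zero 2 hD0) hD0]
    linear_combination (1 - g ^ 2) * (-hlag)
  have hnusq : nu = Real.sqrt rad ∨ nu = -Real.sqrt rad := by
    have h1 : Real.sqrt (nu ^ 2) = |nu| := Real.sqrt_sq_eq_abs nu
    rw [hnu2] at h1
    rcases le_or_gt 0 nu with h | h
    · left; rw [h1, abs_of_nonneg h]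
    · right; rw [h1, abs_of_neg h]; ring
  have hv' : v = lam • a + mu • b + w := by rw [hw]; abel
  rcases hnusq with h | h
  · left; rw [hv', hwnu, h]
  · right; rw [hv', hwnu, h]

/-- **Placement, branch form**: `ρ ≥ 0` and `v` is one of the two branch expressions. -/
theorem place_branches {a b v : Fin 3 → ℝ} (ha : a ⬝ᵥ a = 1) (hb : b ⬝ᵥ b = 1) (hv : v ⬝ᵥ v = 1)
    {ka kb : ℝ} (hka : v ⬝ᵥ a = ka) (hkb : v ⬝ᵥ b = kb) (hg1 : (a ⬝ᵥ b) ^ 2 < 1) :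
    0 ≤ radR (a ⬝ᵥ b) ka kb ∧ (v = brExpr true a b ka kb ∨ v = brExpr false a b ka kb) := by
  obtain ⟨h0, h⟩ := place_decomp ha hb hv rfl hka hkb hg1
  refine ⟨h0, ?_⟩
  rcases h with h | h
  · left; rw [h]; simp [brExpr, lamR, muR, radR]
  · right; rw [h]; simp [brExpr, lamR, muR, radR]

/-! ### The interval placement and its inclusion theorem -/

/-- **Interval placement.**  From boxes `A ∋ a`, `B ∋ b` and intervals `KA ∋ κa`, `KB ∋ κb`,
compute boxes for the two branches `λ a + μ b ± √ρ (a × b)` (clipped to `[-1,1]³`); `none` if the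
division by `1 − g²` cannot be certified positive. -/
def place (A B : IVec) (KA KB : MI) : Option (IVec × IVec) :=
  let g := IVec.dotI A B
  let den := oneI.sub (g.mul SC g)
  match MI.divPos SC oneI den with
  | none => none
  | some inv =>
    let lam := (KA.sub (g.mul SC KB)).mul SC inv
    let mu := (KB.sub (g.mul SC KA)).mul SC inv
    let rad := ((oneI.sub (lam.mul SC KA)).sub (mu.mul SC KB)).mul SC inv
    let nu := sqrtI rad
    let c := IVec.crossI A B
    some ((IVec.linI lam mu nu A B c).clipUnit, (IVec.linI lam mu nu.neg A B c).clipUnit)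

/-- **Inclusion theorem for `place`, branch form.**  If `place A B KA KB = some (P, M)`, the unit
vectors `a ∈ A`, `b ∈ B`, `v` satisfy `⟪v,a⟫ = κa ∈ KA`, `⟪v,b⟫ = κb ∈ KB`, and `v` is the branch
expression of sign `sgn`, then `v ∈ P` (`sgn = true`) resp. `v ∈ M`. -/
theorem mem_place_br {A B P M : IVec} {KA KB : MI} (h : place A B KA KB = some (P, M))
    {a b v : Fin 3 → ℝ} (ha : a ⬝ᵥ a = 1) (hb : b ⬝ᵥ b = 1) (hv : v ⬝ᵥ v = 1)
    (hA : A.mem a) (hB : B.mem b) {ka kb : ℝ} (hka : v ⬝ᵥ a = ka) (hkb : v ⬝ᵥ b = kb)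
    (hKA : MI.mem SC ka KA) (hKB : MI.mem SC kb KB) {sgn : Bool} (hbr : v = brExpr sgn a b ka kb) :
    (if sgn then P else M).mem v := by
  unfold place at h
  simp only at h
  set g := a ⬝ᵥ b with hgdef
  have hgI : MI.mem SC g (IVec.dotI A B) := IVec.mem_dotI hA hB
  have hdenI : MI.mem SC (1 - g * g) (oneI.sub ((IVec.dotI A B).mul SC (IVec.dotI A B))) :=
    MI.mem_sub mem_oneI (MI.mem_mul SC_pos hgI hgI)
  cases hdiv : MI.divPos SC oneI (oneI.sub ((IVec.dotI A B).mul SC (IVec.dotI A B))) with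
  | none => rw [hdiv] at h; exact absurd h (by simp)
  | some inv =>
    rw [hdiv] at h
    simp only [Option.some.injEq, Prod.mk.injEq] at h
    obtain ⟨hP, hM⟩ := h
    have hden_pos : 0 < 1 - g * g := by
      have hlo : 0 < (oneI.sub ((IVec.dotI A B).mul SC (IVec.dotI A B))).lo := by
        unfold MI.divPos at hdiv
        by_contra hle
        rw [if_neg hle] at hdiv
        exact absurd hdiv (by simp)
      exact MI.pos_of_lo_pos hdenI hlo
    have hg1 : g ^ 2 < 1 := by nlinarith
    have hinv : MI.mem SC (1 / (1 - g * g)) inv := MI.mem_divPos SC_pos hdiv mem_oneI hdenI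
    obtain ⟨hrad0, -⟩ := place_branches ha hb hv hka hkb hg1
    have hg2 : (1 : ℝ) - g ^ 2 = 1 - g * g := by ring
    have hlam : MI.mem SC (lamR g ka kb) ((KA.sub ((IVec.dotI A B).mul SC KB)).mul SC inv) := by
      rw [lamR, hg2, div_eq_mul_one_div]
      exact MI.mem_mul SC_pos (MI.mem_sub hKA (MI.mem_mul SC_pos hgI hKB)) hinv
    have hmu : MI.mem SC (muR g ka kb) ((KB.sub ((IVec.dotI A B).mul SC KA)).mul SC inv) := by
      rw [muR, hg2, div_eq_mul_one_div]
      exact MI.mem_mul SC_pos (MI.mem_sub hKB (MI.mem_mul SC_pos hgI hKA)) hinv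
    have hradI : MI.mem SC (radR g ka kb) (((oneI.sub (((KA.sub ((IVec.dotI A B).mul SC KB)).mul
        SC inv).mul SC KA)).sub (((KB.sub ((IVec.dotI A B).mul SC KA)).mul SC inv).mul SC KB)).mul
        SC inv) := by
      rw [radR, hg2, div_eq_mul_one_div]
      exact MI.mem_mul SC_pos (MI.mem_sub (MI.mem_sub mem_oneI (MI.mem_mul SC_pos hlam hKA))
        (MI.mem_mul SC_pos hmu hKB)) hinv
    have hnu : MI.mem SC (Real.sqrt (radR g ka kb)) (sqrtI _) := mem_sqrtI hradI hrad0
    have hnun : MI.mem SC (-Real.sqrt (radR g ka kb)) (sqrtI _).neg := MI.mem_neg hnu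
    have hc : (IVec.crossI A B).mem (a ⨯₃ b) := IVec.mem_crossI hA hB
    cases sgn with
    | true =>
      simp only [if_true]
      rw [← hP]
      have hmem := IVec.mem_linI hlam hmu hnu hA hB hc
      have heq : v = lamR g ka kb • a + muR g ka kb • b + Real.sqrt (radR g ka kb) • (a ⨯₃ b) := by
        rw [hbr]; simp [brExpr, hgdef]
      rw [← heq] at hmem
      exact IVec.mem_clipUnit hmem hv
    | false =>
      simp only [Bool.false_eq_true, if_false]
      rw [← hM]
      have hmem := IVec.mem_linI hlam hmu hnun hA hB hc
      have heq : v = lamR g ka kb • a + muR g ka kb • b + (-Real.sqrt (radR g ka kb)) • (a ⨯₃ b) := by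
        rw [hbr]; simp [brExpr, hgdef]
      rw [← heq] at hmem
      exact IVec.mem_clipUnit hmem hv

/-- If `place` succeeds on boxes containing unit vectors `a, b`, then `⟪a,b⟫² < 1`. -/
theorem sq_lt_one_of_place {A B P M : IVec} {KA KB : MI} (h : place A B KA KB = some (P, M))
    {a b : Fin 3 → ℝ} (hA : A.mem a) (hB : B.mem b) : (a ⬝ᵥ b) ^ 2 < 1 := by
  unfold place at h
  simp only at h
  set g := a ⬝ᵥ b
  have hgI : MI.mem SC g (IVec.dotI A B) := IVec.mem_dotI hA hB
  have hdenI : MI.mem SC (1 - g * g) (oneI.sub ((IVec.dotI A B).mul SC (IVec.dotI A B))) :=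
    MI.mem_sub mem_oneI (MI.mem_mul SC_pos hgI hgI)
  cases hdiv : MI.divPos SC oneI (oneI.sub ((IVec.dotI A B).mul SC (IVec.dotI A B))) with
  | none => rw [hdiv] at h; exact absurd h (by simp)
  | some inv =>
    have hlo : 0 < (oneI.sub ((IVec.dotI A B).mul SC (IVec.dotI A B))).lo := by
      unfold MI.divPos at hdiv
      by_contra hle
      rw [if_neg hle] at hdiv
      exact absurd hdiv (by simp)
    have := MI.pos_of_lo_pos hdenI hlo
    nlinarith

/-- **Inclusion theorem for `place`.**  Under the hypotheses of `mem_place_br`, `v ∈ P` or `v ∈ M`. -/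
theorem mem_place {A B P M : IVec} {KA KB : MI} (h : place A B KA KB = some (P, M))
    {a b v : Fin 3 → ℝ} (ha : a ⬝ᵥ a = 1) (hb : b ⬝ᵥ b = 1) (hv : v ⬝ᵥ v = 1)
    (hA : A.mem a) (hB : B.mem b) {ka kb : ℝ} (hka : v ⬝ᵥ a = ka) (hkb : v ⬝ᵥ b = kb)
    (hKA : MI.mem SC ka KA) (hKB : MI.mem SC kb KB) :
    P.mem v ∨ M.mem v := by
  obtain ⟨-, hbr⟩ := place_branches ha hb hv hka hkb (sq_lt_one_of_place h hA hB)
  rcases hbr with hbr | hbr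
  · exact Or.inl (by simpa using mem_place_br h ha hb hv hA hB hka hkb hKA hKB hbr)
  · exact Or.inr (by simpa using mem_place_br h ha hb hv hA hB hka hkb hKA hKB hbr)

end Rig

end Summit.AtomisticToContinuum.Crystallization.Theorems
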